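import Literature.Analysis.SpecialFunctions.GammaVerticalBounds
import Mathlib.Analysis.SpecialFunctions.Gamma.BohrMollerup
import HarnessLib

/-!
# The functional-equation factor of `ζ` with a sharp constant:
# `‖2(2π)^{-s} Γ(s) cos(πs/2)‖ ≤ e^{1/2} (|t|/2π)^{σ-1/2}` for `1/2 ≤ σ ≤ 2`, `|t| ≥ 2`

Trunk T-ANALYSIS support (`Literature/Analysis/SpecialFunctions`), companion of
`GammaVerticalBounds.lean`.  That file proves `‖Γ(s) cos(πs/2)‖ ≤ 4π² (1+|t|)^{σ-1/2}` on
`1/2 ≤ σ ≤ 1`, i.e. Titchmarsh's `|χ(s)| ≍ (|t|/2π)^{1/2-σ}` ((4.12.3)) up to the constant `8π² ≈ 79`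
for the factor `2(2π)^{-s}Γ(s)cos(πs/2)` of Mathlib's `riemannZeta_one_sub`.  For explicit
zero-counting (Backlund/Jensen bounds for `S(T)`) the constant enters additively as `log 8π² ≈ 4.4`
and must be close to the truth `1`.  Here we prove, by the same elementary method (log-convexity of
`x ↦ Γ(x)²/|Γ(x+iy)|²` and the exact values at `x = 1/2, 1, 3/2` from the reflection formula — no
Stirling formula), the bound with constant `e^{1/2} = 1.6487…`:

* `Literature.Analysis.SpecialFunctions.GammaVert.norm_fe_factor_le_sharp` — for `1/2 ≤ Re s ≤ 2`
  and `|Im s| ≥ 2`, `‖2 (2π)^{-s} Γ(s) cos(πs/2)‖ ≤ e^{1/2} (|Im s|/(2π))^{Re s - 1/2}`.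

The three ranges `[1/2,1]`, `[1,3/2]`, `[3/2,2]` of `Re s` use the secant of the convex function
`log(Γ(x)²/|Γ(x+iy)|²)` through the nodes `(1,3/2)`, `(1/2,1)`, `(1,3/2)` respectively
(extrapolated, so that convexity gives a *lower* bound for it, i.e. an upper bound for `|Γ(x+iy)|`),
the bound `|cos(π(x+iy)/2)|² ≤ cosh²(πy/2) = (1 + cosh πy)/2`, and `log Γ(x) ≤ (1-x) log π`,
`≤ (2x-2) log Γ(3/2)`, `≤ 0` on the three ranges (log-convexity of `Γ`).  The loss against Stirling
is the factor `π/2` at `x → 1/2⁺` (where the secant through `1, 3/2` is poorest), whence the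
constant `e^{1/2} > π/2 · 1.002`.  Everything here is proved; no definitions, no named facts.

## References

* E. C. Titchmarsh, *The Theory of the Riemann Zeta-Function*, 2nd ed. (1986), §4.12, (4.12.3).
* E. T. Whittaker, G. N. Watson, *A Course of Modern Analysis*, 4th ed., §12.13–12.14, §13.6.
-/

noncomputable section

open Real Set Filter Topology Complex

namespace Literature.Analysis.SpecialFunctions.GammaVert

/-! ### Numerical lemmas -/

/-- `e^{2π} > 403` (`e > 2.718`, `2π > 6`). [folklore] -/
lemma exp_two_pi_gt : (403 : ℝ) < Real.exp (2 * π) := by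
  have h1 : Real.exp 6 ≤ Real.exp (2 * π) := Real.exp_le_exp.2 (by linarith [Real.pi_gt_three])
  have h2 : (403 : ℝ) < Real.exp 6 := by
    have he := Real.exp_one_gt_d9
    have : Real.exp 6 = Real.exp 1 ^ 6 := by rw [← Real.exp_nat_mul]; norm_num
    rw [this]
    have h0 : (0 : ℝ) ≤ 2.7182818283 := by norm_num
    calc (403 : ℝ) < 2.7182818283 ^ 6 := by norm_num
      _ ≤ Real.exp 1 ^ 6 := pow_le_pow_left₀ h0 he.le 6
  linarith

/-- `cosh(πy) ≥ 200` and `sinh(πy) ≥ 200` for `y ≥ 2`. [folklore] -/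
lemma cosh_sinh_ge_of_two_le {y : ℝ} (hy : 2 ≤ y) :
    200 ≤ Real.cosh (π * y) ∧ 200 ≤ Real.sinh (π * y) := by
  have h1 : Real.exp (2 * π) ≤ Real.exp (π * y) := Real.exp_le_exp.2 (by nlinarith [Real.pi_pos])
  have h2 := exp_two_pi_gt
  have h3 : 0 < Real.exp (-(π * y)) := Real.exp_pos _
  have h4 : Real.exp (-(π * y)) ≤ 1 := by
    rw [Real.exp_le_one_iff]; nlinarith [Real.pi_pos]
  rw [Real.cosh_eq, Real.sinh_eq]
  constructor <;> linarith

/-- `log cosh(πy) - log sinh(πy) ≤ 10⁻⁴` for `y ≥ 2` (`cosh² = sinh² + 1`, `sinh ≥ 200`). [folklore] -/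
lemma log_cosh_sub_log_sinh_le {y : ℝ} (hy : 2 ≤ y) :
    Real.log (Real.cosh (π * y)) - Real.log (Real.sinh (π * y)) ≤ 1 / 10000 := by
  obtain ⟨hc, hs⟩ := cosh_sinh_ge_of_two_le hy
  set c := Real.cosh (π * y)
  set s := Real.sinh (π * y)
  have hcs : c ^ 2 = s ^ 2 + 1 := Real.cosh_sq (π * y)
  -- `c ≤ s (1 + 10⁻⁴)`
  have hle : c ≤ s * (1 + 1 / 10000) := by
    have h0 : 0 ≤ s * (1 + 1 / 10000) := by positivity
    rw [← pow_le_pow_iff_left₀ (by linarith) h0 two_ne_zero]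
    nlinarith
  rw [sub_le_iff_le_add, add_comm, ← Real.log_exp (1 / 10000),
    ← Real.log_mul (by linarith : s ≠ 0) (Real.exp_pos _).ne']
  refine Real.log_le_log (by linarith) (hle.trans ?_)
  gcongr
  have := Real.add_one_le_exp (1 / 10000 : ℝ)
  linarith

/-- `log((1 + cosh πy)/2) ≤ log cosh(πy) - log 2 + 1/200` for `y ≥ 2` (`cosh πy ≥ 200`). [folklore] -/
lemma log_half_add_cosh_le {y : ℝ} (hy : 2 ≤ y) :
    Real.log ((1 + Real.cosh (π * y)) / 2) ≤ Real.log (Real.cosh (π * y)) - Real.log 2 + 1 / 200 := by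
  obtain ⟨hc, -⟩ := cosh_sinh_ge_of_two_le hy
  set c := Real.cosh (π * y)
  have h1 : (1 + c) / 2 ≤ c / 2 * Real.exp (1 / 200) := by
    have := Real.add_one_le_exp (1 / 200 : ℝ)
    nlinarith
  calc Real.log ((1 + c) / 2) ≤ Real.log (c / 2 * Real.exp (1 / 200)) :=
        Real.log_le_log (by linarith) h1
    _ = Real.log c - Real.log 2 + 1 / 200 := by
        rw [Real.log_mul (by positivity) (Real.exp_pos _).ne', Real.log_div (by linarith) two_ne_zero,
          Real.log_exp]

/-- `log π - log 2 ≤ 49/100` (`π/2 ≤ 1.58 ≤ e^{0.49}`). [folklore] -/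
lemma log_pi_sub_log_two_le : Real.log π - Real.log 2 ≤ 49 / 100 := by
  rw [← Real.log_div Real.pi_pos.ne' two_ne_zero, ← Real.log_exp (49 / 100)]
  refine Real.log_le_log (by positivity) ?_
  have h := Real.quadratic_le_exp_of_nonneg (show (0 : ℝ) ≤ 49 / 100 by norm_num)
  have := Real.pi_lt_d2
  nlinarith

/-- `log 4 - log π ≤ 1/4` (`4/π ≤ 1.28 ≤ e^{1/4}`). [folklore] -/
lemma log_four_sub_log_pi_le : Real.log 4 - Real.log π ≤ 1 / 4 := by
  rw [← Real.log_div (by norm_num) Real.pi_pos.ne', ← Real.log_exp (1 / 4)]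
  refine Real.log_le_log (by positivity) ?_
  have h := Real.quadratic_le_exp_of_nonneg (show (0 : ℝ) ≤ 1 / 4 by norm_num)
  have := Real.pi_gt_d2
  rw [div_le_iff₀ Real.pi_pos]
  nlinarith

/-- `‖cos(π(x+iy)/2)‖² ≤ (1 + cosh πy)/2` (`= cosh²(πy/2)`). [folklore] -/
lemma norm_sq_cos_le (x y : ℝ) :
    ‖Complex.cos (π * (x + y * I) / 2)‖ ^ 2 ≤ (1 + Real.cosh (π * y)) / 2 := by
  have h1 := norm_cos_le_cosh_im (π * (x + y * I) / 2)
  have him : (π * (x + y * I) / 2 : ℂ).im = π * y / 2 := by simp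
  rw [him] at h1
  have h3 : Real.cosh (π * y) = 2 * Real.cosh (π * y / 2) ^ 2 - 1 := by
    have := Real.cosh_two_mul (π * y / 2)
    have h4 := Real.cosh_sq (π * y / 2)
    rw [show 2 * (π * y / 2) = π * y by ring] at this
    linarith
  calc ‖Complex.cos (π * (x + y * I) / 2)‖ ^ 2 ≤ Real.cosh (π * y / 2) ^ 2 := by
        gcongr
    _ = (1 + Real.cosh (π * y)) / 2 := by rw [h3]; ring

/-- `0 < ‖cos(π(x+iy)/2)‖` for `y ≠ 0`. [folklore] -/
lemma norm_cos_pos {x y : ℝ} (hy : y ≠ 0) : 0 < ‖Complex.cos (π * (x + y * I) / 2)‖ := by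
  rw [norm_pos_iff]
  intro h
  rw [Complex.cos_eq_zero_iff] at h
  obtain ⟨k, hk⟩ := h
  have him := congrArg Complex.im hk
  have h1 : (π * (x + y * I) / 2 : ℂ).im = π * y / 2 := by simp
  have h2 : ((2 * (k : ℂ) + 1) * π / 2).im = 0 := by simp
  rw [h1, h2] at him
  have : π * y = 0 := by linarith
  rcases mul_eq_zero.1 this with h | h
  · exact Real.pi_ne_zero h
  · exact hy h

/-! ### Secant bounds from log-convexity -/

/-- Secant through the nodes `1/2 < 1`, evaluated at `x ≥ 1`:
`(2x-1) log Q(1) - (2x-2) log Q(1/2) ≤ log Q(x)`, `Q(x) = Γ(x)²/‖Γ(x+iy)‖²`. [folklore] -/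
lemma log_gammaRatio_ge_of_one_le (y : ℝ) {x : ℝ} (hx : 1 ≤ x) :
    (2 * x - 1) * Real.log (Real.Gamma 1 ^ 2 / ‖Complex.Gamma ((1 : ℝ) + y * I)‖ ^ 2) -
        (2 * x - 2) * Real.log (Real.Gamma (1 / 2) ^ 2 / ‖Complex.Gamma ((1 / 2 : ℝ) + y * I)‖ ^ 2) ≤
      Real.log (Real.Gamma x ^ 2 / ‖Complex.Gamma (x + y * I)‖ ^ 2) := by
  rcases eq_or_lt_of_le hx with rfl | hlt
  · norm_num
  have h := slope_log_gammaRatio_mono y (by norm_num : (0 : ℝ) < 1 / 2) (by norm_num : (1 / 2 : ℝ) < 1) hlt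
  rw [div_le_div_iff₀ (by norm_num) (by linarith)] at h
  nlinarith

/-- Secant through the nodes `1 < 3/2`, evaluated at `x ≥ 3/2`:
`(2x-2) log Q(3/2) - (2x-3) log Q(1) ≤ log Q(x)`. [folklore] -/
lemma log_gammaRatio_ge_of_three_halves_le (y : ℝ) {x : ℝ} (hx : 3 / 2 ≤ x) :
    (2 * x - 2) * Real.log (Real.Gamma (3 / 2) ^ 2 / ‖Complex.Gamma ((3 / 2 : ℝ) + y * I)‖ ^ 2) -
        (2 * x - 3) * Real.log (Real.Gamma 1 ^ 2 / ‖Complex.Gamma ((1 : ℝ) + y * I)‖ ^ 2) ≤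
      Real.log (Real.Gamma x ^ 2 / ‖Complex.Gamma (x + y * I)‖ ^ 2) := by
  rcases eq_or_lt_of_le hx with rfl | hlt
  · norm_num
  have h := slope_log_gammaRatio_mono y (by norm_num : (0 : ℝ) < 1) (by norm_num : (1 : ℝ) < 3 / 2) hlt
  rw [div_le_div_iff₀ (by norm_num) (by linarith)] at h
  nlinarith

/-! ### `log Γ(x)` on `[1/2, 2]` -/

/-- `log Γ(3/2) = ½ log π - log 2` (`Γ(3/2) = √π/2`). [folklore] -/
lemma log_Gamma_three_halves : Real.log (Real.Gamma (3 / 2)) = Real.log π / 2 - Real.log 2 := by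
  rw [show (3 / 2 : ℝ) = 1 / 2 + 1 by norm_num, Real.Gamma_add_one (by norm_num),
    Real.Gamma_one_half_eq, Real.log_mul (by norm_num) (by positivity), Real.log_sqrt Real.pi_pos.le,
    Real.log_div one_ne_zero two_ne_zero, Real.log_one]
  ring

/-- `log Γ(x) ≤ (1-x) log π` for `1/2 ≤ x ≤ 1` (log-convexity between `Γ(1/2) = √π`, `Γ(1) = 1`).
[folklore] -/
lemma log_Gamma_le_of_mem_Icc₁ {x : ℝ} (h1 : 1 / 2 ≤ x) (h2 : x ≤ 1) :
    Real.log (Real.Gamma x) ≤ (1 - x) * Real.log π := by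
  have h := Real.convexOn_log_Gamma.2 (show (1 / 2 : ℝ) ∈ Ioi 0 by norm_num)
    (show (1 : ℝ) ∈ Ioi 0 by norm_num) (show (0 : ℝ) ≤ 2 - 2 * x by linarith)
    (show (0 : ℝ) ≤ 2 * x - 1 by linarith) (by ring)
  simp only [Function.comp_apply, smul_eq_mul, Real.Gamma_one, Real.log_one, mul_zero, add_zero,
    Real.Gamma_one_half_eq, Real.log_sqrt Real.pi_pos.le] at h
  rw [show (2 - 2 * x) * (1 / 2) + (2 * x - 1) * 1 = x by ring] at h
  linarith

/-- `log Γ(x) ≤ (2x-2) log Γ(3/2)` for `1 ≤ x ≤ 3/2` (log-convexity between `1` and `3/2`).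
[folklore] -/
lemma log_Gamma_le_of_mem_Icc₂ {x : ℝ} (h1 : 1 ≤ x) (h2 : x ≤ 3 / 2) :
    Real.log (Real.Gamma x) ≤ (2 * x - 2) * (Real.log π / 2 - Real.log 2) := by
  have h := Real.convexOn_log_Gamma.2 (show (1 : ℝ) ∈ Ioi 0 by norm_num)
    (show (3 / 2 : ℝ) ∈ Ioi 0 by norm_num) (show (0 : ℝ) ≤ 3 - 2 * x by linarith)
    (show (0 : ℝ) ≤ 2 * x - 2 by linarith) (by ring)
  simp only [Function.comp_apply, smul_eq_mul, Real.Gamma_one, Real.log_one, mul_zero, zero_add,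
    log_Gamma_three_halves] at h
  rw [show (3 - 2 * x) * 1 + (2 * x - 2) * (3 / 2) = x by ring] at h
  exact h

/-- `log Γ(x) ≤ 0` for `3/2 ≤ x ≤ 2` (convexity, `Γ(3/2) = √π/2 < 1 = Γ(2)`). [folklore] -/
lemma log_Gamma_le_of_mem_Icc₃ {x : ℝ} (h1 : 3 / 2 ≤ x) (h2 : x ≤ 2) :
    Real.log (Real.Gamma x) ≤ 0 := by
  have h := Real.convexOn_log_Gamma.2 (show (3 / 2 : ℝ) ∈ Ioi 0 by norm_num)
    (show (2 : ℝ) ∈ Ioi 0 by norm_num) (show (0 : ℝ) ≤ 4 - 2 * x by linarith)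
    (show (0 : ℝ) ≤ 2 * x - 3 by linarith) (by ring)
  simp only [Function.comp_apply, smul_eq_mul, Real.Gamma_two, Real.log_one, mul_zero, add_zero,
    log_Gamma_three_halves] at h
  rw [show (4 - 2 * x) * (3 / 2) + (2 * x - 3) * 2 = x by ring] at h
  have h3 : Real.log π / 2 - Real.log 2 ≤ 0 := by
    have := log_pi_sub_log_two_le
    have := Real.log_two_gt_d9
    linarith
  nlinarith [mul_nonneg (by linarith : (0 : ℝ) ≤ 4 - 2 * x)
    (by linarith : (0 : ℝ) ≤ -(Real.log π / 2 - Real.log 2))]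

/-! ### The three ranges of `x = Re s` -/

/-- `Γ(1/2)²/‖Γ(1/2+iy)‖² = cosh(πy)`. [folklore] -/
lemma gammaRatio_half (y : ℝ) :
    Real.Gamma (1 / 2) ^ 2 / ‖Complex.Gamma ((1 / 2 : ℝ) + y * I)‖ ^ 2 = Real.cosh (π * y) := by
  have hc : 0 < Real.cosh (π * y) := Real.cosh_pos _
  rw [Real_Gamma_half_sq, show ((1 / 2 : ℝ) : ℂ) = 1 / 2 by push_cast; ring, norm_sq_Gamma_half]
  field_simp

/-- Common form of the logarithm of the Gamma ratio. [folklore] -/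
lemma log_gammaRatio_eq {x : ℝ} (hx : 0 < x) (y : ℝ) :
    Real.log (Real.Gamma x ^ 2 / ‖Complex.Gamma (x + y * I)‖ ^ 2) =
      2 * Real.log (Real.Gamma x) - 2 * Real.log ‖Complex.Gamma (x + y * I)‖ := by
  have hΓpos : 0 < ‖Complex.Gamma (x + y * I)‖ := norm_pos_iff.mpr (Gamma_ne_zero_of_pos hx y)
  have hΓx : 0 < Real.Gamma x := Real.Gamma_pos_of_pos hx
  rw [Real.log_div (by positivity) (by positivity), Real.log_pow, Real.log_pow]
  push_cast
  ring

/-- The cosine factor in logarithmic form: `2 log ‖cos(π(x+iy)/2)‖ ≤ log cosh(πy) - log 2 + 1/200`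
for `y ≥ 2`. [folklore] -/
lemma two_log_norm_cos_le {x y : ℝ} (hy : 2 ≤ y) :
    2 * Real.log ‖Complex.cos (π * (x + y * I) / 2)‖ ≤
      Real.log (Real.cosh (π * y)) - Real.log 2 + 1 / 200 := by
  have hy0 : y ≠ 0 := by intro h; rw [h] at hy; norm_num at hy
  have h1 := norm_sq_cos_le x y
  have hpos := norm_cos_pos (x := x) hy0
  have h2 : 2 * Real.log ‖Complex.cos (π * (x + y * I) / 2)‖ =
      Real.log (‖Complex.cos (π * (x + y * I) / 2)‖ ^ 2) := by
    rw [Real.log_pow]; push_cast; ring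
  rw [h2]
  exact (Real.log_le_log (by positivity) h1).trans (log_half_add_cosh_le hy)

/-- Range `1/2 ≤ x ≤ 1` (secant through `1, 3/2`). [folklore] -/
lemma two_log_norm_Gamma_add_le₁ {x y : ℝ} (hx : 1 / 2 ≤ x) (hx1 : x ≤ 1) (hy : 2 ≤ y) :
    2 * Real.log ‖Complex.Gamma (x + y * I)‖ + 2 * Real.log ‖Complex.cos (π * (x + y * I) / 2)‖ ≤
      1 + Real.log π - Real.log 2 + (2 * x - 1) * Real.log y := by
  have hx0 : 0 < x := by linarith
  have hy0 : 0 < y := by linarith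
  obtain ⟨hc, hs⟩ := cosh_sinh_ge_of_two_le hy
  have hQ := log_gammaRatio_ge y hx0 hx1
  rw [gammaRatio_one hy0.ne', gammaRatio_three_halves, log_gammaRatio_eq hx0,
    Real.log_div (by linarith) (by positivity), Real.log_mul Real.pi_pos.ne' hy0.ne',
    Real.log_div (by linarith) (by positivity)] at hQ
  have hcos := two_log_norm_cos_le (x := x) hy
  have hcs := log_cosh_sub_log_sinh_le hy
  have hΓlog := log_Gamma_le_of_mem_Icc₁ hx hx1
  have hlog4 : 2 * Real.log 2 + 2 * Real.log y ≤ Real.log (1 + 4 * y ^ 2) := by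
    have : 2 * Real.log 2 + 2 * Real.log y = Real.log (4 * y ^ 2) := by
      rw [Real.log_mul (by norm_num) (by positivity), Real.log_pow, show (4 : ℝ) = 2 ^ 2 by norm_num,
        Real.log_pow]; push_cast; ring
    rw [this]
    exact Real.log_le_log (by positivity) (by linarith)
  have hπ2 := log_pi_sub_log_two_le
  have P1 : (3 - 2 * x) * (Real.log (Real.cosh (π * y)) - Real.log (Real.sinh (π * y))) ≤
      2 * (1 / 10000) := by
    calc (3 - 2 * x) * (Real.log (Real.cosh (π * y)) - Real.log (Real.sinh (π * y)))
        ≤ (3 - 2 * x) * (1 / 10000) := mul_le_mul_of_nonneg_left hcs (by linarith)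
      _ ≤ 2 * (1 / 10000) := by nlinarith
  have P2 : 0 ≤ (2 - 2 * x) * (Real.log (1 + 4 * y ^ 2) - 2 * Real.log 2 - 2 * Real.log y) :=
    mul_nonneg (by linarith) (by linarith)
  have P3 : (4 - 4 * x) * (Real.log π - Real.log 2) ≤ (4 - 4 * x) * (49 / 100) :=
    mul_le_mul_of_nonneg_left hπ2 (by linarith)
  nlinarith [P1, P2, P3, hQ, hcos, hΓlog]

/-- Range `1 ≤ x ≤ 3/2` (secant through `1/2, 1`). [folklore] -/
lemma two_log_norm_Gamma_add_le₂ {x y : ℝ} (hx : 1 ≤ x) (hx1 : x ≤ 3 / 2) (hy : 2 ≤ y) :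
    2 * Real.log ‖Complex.Gamma (x + y * I)‖ + 2 * Real.log ‖Complex.cos (π * (x + y * I) / 2)‖ ≤
      1 + Real.log π - Real.log 2 + (2 * x - 1) * Real.log y := by
  have hx0 : 0 < x := by linarith
  have hy0 : 0 < y := by linarith
  obtain ⟨hc, hs⟩ := cosh_sinh_ge_of_two_le hy
  have hQ := log_gammaRatio_ge_of_one_le y hx
  rw [gammaRatio_one hy0.ne', gammaRatio_half, log_gammaRatio_eq hx0,
    Real.log_div (by linarith) (by positivity), Real.log_mul Real.pi_pos.ne' hy0.ne'] at hQ
  have hcos := two_log_norm_cos_le (x := x) hy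
  have hcs := log_cosh_sub_log_sinh_le hy
  have hΓlog := log_Gamma_le_of_mem_Icc₂ hx hx1
  have hπ2 := log_pi_sub_log_two_le
  have P1 : (2 * x - 1) * (Real.log (Real.cosh (π * y)) - Real.log (Real.sinh (π * y))) ≤
      2 * (1 / 10000) := by
    calc (2 * x - 1) * (Real.log (Real.cosh (π * y)) - Real.log (Real.sinh (π * y)))
        ≤ (2 * x - 1) * (1 / 10000) := mul_le_mul_of_nonneg_left hcs (by linarith)
      _ ≤ 2 * (1 / 10000) := by nlinarith
  have P3 : (4 * x - 4) * (Real.log π - Real.log 2) ≤ (4 * x - 4) * (49 / 100) :=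
    mul_le_mul_of_nonneg_left hπ2 (by linarith)
  nlinarith [P1, P3, hQ, hcos, hΓlog]

/-- Range `3/2 ≤ x ≤ 2` (secant through `1, 3/2`, extrapolated to the right). [folklore] -/
lemma two_log_norm_Gamma_add_le₃ {x y : ℝ} (hx : 3 / 2 ≤ x) (hx1 : x ≤ 2) (hy : 2 ≤ y) :
    2 * Real.log ‖Complex.Gamma (x + y * I)‖ + 2 * Real.log ‖Complex.cos (π * (x + y * I) / 2)‖ ≤
      1 + Real.log π - Real.log 2 + (2 * x - 1) * Real.log y := by
  have hx0 : 0 < x := by linarith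
  have hy0 : 0 < y := by linarith
  obtain ⟨hc, hs⟩ := cosh_sinh_ge_of_two_le hy
  have hQ := log_gammaRatio_ge_of_three_halves_le y hx
  rw [gammaRatio_one hy0.ne', gammaRatio_three_halves, log_gammaRatio_eq hx0,
    Real.log_div (by linarith : Real.sinh (π * y) ≠ 0) (by positivity : π * y ≠ 0),
    Real.log_mul Real.pi_pos.ne' hy0.ne',
    Real.log_div (by linarith : Real.cosh (π * y) ≠ 0) (by positivity : (1 + 4 * y ^ 2 : ℝ) ≠ 0)] at hQ
  have hcos := two_log_norm_cos_le (x := x) hy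
  have hΓlog := log_Gamma_le_of_mem_Icc₃ hx hx1
  -- `log sinh ≤ log cosh`
  have hsc : Real.log (Real.sinh (π * y)) ≤ Real.log (Real.cosh (π * y)) := by
    refine Real.log_le_log (by linarith) ?_
    have := Real.cosh_sq (π * y)
    nlinarith
  -- `log(1 + 4y²) ≤ log 4 + 2 log y + 1/16`
  have hlog4 : Real.log (1 + 4 * y ^ 2) ≤ 2 * Real.log 2 + 2 * Real.log y + 1 / 16 := by
    have h16 := Real.add_one_le_exp (1 / 16 : ℝ)
    have hy2 : 4 ≤ y ^ 2 := by nlinarith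
    have hle : 1 + 4 * y ^ 2 ≤ 4 * y ^ 2 * Real.exp (1 / 16) := by nlinarith
    calc Real.log (1 + 4 * y ^ 2) ≤ Real.log (4 * y ^ 2 * Real.exp (1 / 16)) :=
          Real.log_le_log (by positivity) hle
      _ = 2 * Real.log 2 + 2 * Real.log y + 1 / 16 := by
          rw [Real.log_mul (by positivity) (Real.exp_pos _).ne', Real.log_mul (by norm_num) (by positivity),
            Real.log_exp, Real.log_pow, show (4 : ℝ) = 2 ^ 2 by norm_num, Real.log_pow]
          push_cast; ring
  have hπ4 := log_four_sub_log_pi_le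
  have hlog4' : Real.log 4 = 2 * Real.log 2 := by
    rw [show (4 : ℝ) = 2 ^ 2 by norm_num, Real.log_pow]; push_cast; ring
  rw [hlog4'] at hπ4
  have P1 : (2 * x - 3) * (Real.log (Real.sinh (π * y)) - Real.log (Real.cosh (π * y))) ≤ 0 :=
    mul_nonpos_iff.2 (Or.inl ⟨by linarith, by linarith⟩)
  have P2 : (2 * x - 2) * (Real.log (1 + 4 * y ^ 2) - 2 * Real.log 2 - 2 * Real.log y) ≤
      (2 * x - 2) * (1 / 16) := mul_le_mul_of_nonneg_left (by linarith) (by linarith)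
  have P3 : (2 * x - 2) * (2 * Real.log 2 - Real.log π) ≤ (2 * x - 2) * (1 / 4) :=
    mul_le_mul_of_nonneg_left hπ4 (by linarith)
  nlinarith [P1, P2, P3, hQ, hcos, hΓlog]

/-- The three ranges together: for `1/2 ≤ x ≤ 2`, `y ≥ 2`,
`2 log‖Γ(x+iy)‖ + 2 log‖cos(π(x+iy)/2)‖ ≤ 1 + log(π/2) + (2x-1) log y`. [folklore] -/
lemma two_log_norm_Gamma_add_le {x y : ℝ} (hx : 1 / 2 ≤ x) (hx1 : x ≤ 2) (hy : 2 ≤ y) :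
    2 * Real.log ‖Complex.Gamma (x + y * I)‖ + 2 * Real.log ‖Complex.cos (π * (x + y * I) / 2)‖ ≤
      1 + Real.log π - Real.log 2 + (2 * x - 1) * Real.log y := by
  rcases le_or_gt x 1 with h1 | h1
  · exact two_log_norm_Gamma_add_le₁ hx h1 hy
  rcases le_or_gt x (3 / 2) with h2 | h2
  · exact two_log_norm_Gamma_add_le₂ h1.le h2 hy
  · exact two_log_norm_Gamma_add_le₃ h2.le hx1 hy

/-! ### The functional-equation factor -/

/-- **The functional-equation factor with constant `e^{1/2}`.**  For `1/2 ≤ Re s ≤ 2` and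
`|Im s| ≥ 2`,
`‖2 (2π)^{-s} Γ(s) cos(πs/2)‖ ≤ e^{1/2} (|Im s|/(2π))^{Re s - 1/2}`
(the factor of Mathlib's `riemannZeta_one_sub : ζ(1-s) = 2(2π)^{-s}Γ(s)cos(πs/2)ζ(s)`;
Titchmarsh (4.12.3) `|χ| ~ (|t|/2π)^{1/2-σ}` with the explicit constant `e^{1/2} = 1.6487…` in place
of `1 + o(1)`). [cite: Titchmarsh1986, §4.12 (4.12.3)] -/
theorem norm_fe_factor_le_sharp {s : ℂ} (hs : 1 / 2 ≤ s.re) (hs2 : s.re ≤ 2) (ht : 2 ≤ |s.im|) :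
    ‖2 * (2 * (π : ℂ)) ^ (-s) * Complex.Gamma s * Complex.cos (π * s / 2)‖ ≤
      Real.exp (1 / 2) * (|s.im| / (2 * π)) ^ (s.re - 1 / 2) := by
  have hπ := Real.pi_pos
  set x := s.re with hxdef
  set y := s.im with hydef
  have hx0 : 0 < x := by linarith
  have hs' : s = (x : ℂ) + (y : ℂ) * I := (Complex.re_add_im s).symm
  have hy0 : 0 < |y| := by linarith
  -- symmetry `y ↦ -y`
  have hsymm : ‖Complex.Gamma s‖ * ‖Complex.cos (π * s / 2)‖ =
      ‖Complex.Gamma (x + |y| * I)‖ * ‖Complex.cos (π * (x + |y| * I) / 2)‖ := by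
    rcases le_or_gt 0 y with hy | hy
    · rw [abs_of_nonneg hy, ← hs']
    · have e1 : (x : ℂ) + (|y| : ℝ) * I = (starRingEnd ℂ) ((x : ℂ) + (y : ℂ) * I) := by
        rw [abs_of_neg hy]; apply Complex.ext <;> simp
      have e2 : (π : ℂ) * ((x : ℂ) + (|y| : ℝ) * I) / 2 =
          (starRingEnd ℂ) (π * ((x : ℂ) + (y : ℂ) * I) / 2) := by
        rw [abs_of_neg hy]; apply Complex.ext <;> simp [map_ofNat]
      rw [hs', e2, e1, Complex.Gamma_conj, Complex.norm_conj, Complex.cos_conj, Complex.norm_conj]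
  have hΓ : 0 < ‖Complex.Gamma (x + |y| * I)‖ := norm_pos_iff.mpr (Gamma_ne_zero_of_pos hx0 |y|)
  have hcos : 0 < ‖Complex.cos (π * (x + |y| * I) / 2)‖ := norm_cos_pos hy0.ne'
  set P := ‖Complex.Gamma (x + |y| * I)‖ * ‖Complex.cos (π * (x + |y| * I) / 2)‖ with hP
  have hPpos : 0 < P := mul_pos hΓ hcos
  have hkey := two_log_norm_Gamma_add_le hs hs2 ht
  have hlogP : Real.log P ≤ 1 / 2 + (Real.log π - Real.log 2) / 2 + (x - 1 / 2) * Real.log |y| := by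
    rw [hP, Real.log_mul hΓ.ne' hcos.ne']
    linarith
  have hpow : ‖(2 * (π : ℂ)) ^ (-s)‖ = (2 * π) ^ (-x) := by
    rw [show (2 * (π : ℂ)) = ((2 * π : ℝ) : ℂ) by push_cast; ring,
      Complex.norm_cpow_eq_rpow_re_of_pos (by positivity)]
    simp [hxdef]
  have hF : ‖2 * (2 * (π : ℂ)) ^ (-s) * Complex.Gamma s * Complex.cos (π * s / 2)‖ =
      2 * (2 * π) ^ (-x) * P := by
    simp only [norm_mul, Complex.norm_ofNat, hpow]
    rw [mul_assoc, hsymm, hP]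
  rw [hF]
  have h2π : 0 < 2 * π := by positivity
  have hlogF : Real.log (2 * (2 * π) ^ (-x) * P) =
      Real.log 2 - x * (Real.log 2 + Real.log π) + Real.log P := by
    rw [Real.log_mul (by positivity) hPpos.ne', Real.log_mul two_ne_zero (by positivity),
      Real.log_rpow h2π, Real.log_mul two_ne_zero hπ.ne']
    ring
  calc 2 * (2 * π) ^ (-x) * P = Real.exp (Real.log (2 * (2 * π) ^ (-x) * P)) :=
        (Real.exp_log (by positivity)).symm
    _ ≤ Real.exp (1 / 2 + (x - 1 / 2) * (Real.log |y| - Real.log (2 * π))) := by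
        rw [Real.exp_le_exp, hlogF, Real.log_mul two_ne_zero hπ.ne']
        linarith
    _ = Real.exp (1 / 2) * (|y| / (2 * π)) ^ (x - 1 / 2) := by
        rw [Real.exp_add, Real.rpow_def_of_pos (by positivity), Real.log_div hy0.ne' h2π.ne']
        ring_nf

end Literature.Analysis.SpecialFunctions.GammaVert

end
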